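import Summits.Ventures.PercRepro.RankLevelSetRuleQSliceDiag

/-!
# PercRepro — THE SLICE SUMS AGAINST THEIR DIAGONAL: MOMENT BOUNDS UNIFORM IN THE DEGREE (night-1, gen 22; dossier §33)

The slice sums `S_j(q, m) = Σ_{a ≤ m} C(m, a)/C(q+j+a, a+j)` carry the untruncated part of `R̂(q, k, m)`. Their two
recursions in the tree — Pascal in `m` (`rhatSliceSum_succ`) and the slice step in `q` (`slice_sum_step`) — say that
`S_j(q, m)/q` is antitone in `q` and pin every sum to the DIAGONAL `J_j(m) := S_j(m+1, m)`:
* `sliceS` — the slice sum as a function (the tree spells it out; `sliceS_succ_m`, `sliceS_step`, `sliceS_anti` restate the tree);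
* **`sliceS_le_diag`** — `S_j(q, m) ≤ (q/(m+1))·J_j(m)` for `q ≥ m + 1`; **`sliceS_ge_diag`** — `S_j(m+1+t, m) ≥ ((m+1+t)/(m+1))·(J_j(m) − t·J_{j+1}(m))`;
* `diag_succ` — `J_j(m+1) = ((m+2)/(m+1))·(J_j(m) − J_{j+2}(m))`; **`diag_odd`** — `J_{2d+1}(m) = 1/(2·C(m+d+1, d))` EXACTLY;
* `xq_succ`, **`xq_sq_le_sharp`** — `X_{Q+1} = X_Q·(2Q+2)/(2Q+1)` and the sharp Wallis bound `X_Q² ≤ (8/9)(2Q+1)²/(Q+1)` for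
  `X_Q = 4^Q/C(2Q, Q)` (equality at `Q = 1`); hence **`diag_two_sq_le`** — `(2·J_2(m))² ≤ 8/(9(m+2))`;
* **`sliceS_one_ge`** — `S_1(m+1+t, m) ≥ ((m+1+t)/(2(m+1)))·(1 − t·(2J_2(m)))`; **`sliceS_le_odd`** — `S_j(q, m) ≤ (q/(m+1))/(2·C(m+d+1, d))`
  for every `j ≥ 2d + 1` and `q ≥ m + 1`.
(In the integral reading `J_j(m) = (m+1)∫₀¹ t^j (1−t²)^m dt`: the first bound is `(1−t)^{q−m−1} ≤ 1`, the second is Bernoulli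
`(1−t)^{t'} ≥ 1 − t'·t`; the discrete proofs use only the two recursions.) Axioms: standard.
-/

namespace PercRepro

open Finset

/-- The slice sum `S_j(q, m) = Σ_{a ≤ m} C(m, a)/C(q + j + a, a + j)` as a function (the tree spells it out). -/
def sliceS (q m j : ℕ) : ℚ := ∑ a ∈ range (m + 1), (m.choose a : ℚ) / ((q + j + a).choose (a + j) : ℚ)

/-- The slice sums are nonnegative. -/
lemma sliceS_nonneg (q m j : ℕ) : 0 ≤ sliceS q m j :=
  Finset.sum_nonneg (fun a _ => by positivity)

/-- Pascal in the slice sums (`rhatSliceSum_succ`): `S_j(q, m+1) = S_j(q, m) + S_{j+1}(q, m)`. -/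
lemma sliceS_succ_m (q m j : ℕ) : sliceS q (m + 1) j = sliceS q m j + sliceS q m (j + 1) :=
  rhatSliceSum_succ q m j

/-- The slice step (`slice_sum_step`): `S_{j+1}(q, m) = S_j(q, m) − (q/(q+1))·S_j(q+1, m)`. -/
lemma sliceS_step (q m j : ℕ) :
    sliceS q m (j + 1) = sliceS q m j - (q : ℚ) / ((q : ℚ) + 1) * sliceS (q + 1) m j :=
  slice_sum_step q m j

/-- `S_{j+1}(q, m) ≤ S_j(q, m)` (`slice_anti_j`). -/
lemma sliceS_anti_succ (q m j : ℕ) : sliceS q m (j + 1) ≤ sliceS q m j :=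
  slice_anti_j q m j

/-- `S_{j'}(q, m) ≤ S_j(q, m)` for `j ≤ j'`. -/
lemma sliceS_anti (q m : ℕ) {j j' : ℕ} (h : j ≤ j') : sliceS q m j' ≤ sliceS q m j := by
  induction j', h using Nat.le_induction with
  | base => exact le_rfl
  | succ j' _ ih => exact (sliceS_anti_succ q m j').trans ih

/-- `S_j(q+1, m) = ((q+1)/q)·(S_j(q, m) − S_{j+1}(q, m))` for `q ≥ 1`. -/
lemma sliceS_succ_q (q m j : ℕ) (hq : 1 ≤ q) :
    sliceS (q + 1) m j = ((q : ℚ) + 1) / (q : ℚ) * (sliceS q m j - sliceS q m (j + 1)) := by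
  have h := sliceS_step q m j
  have hq' : (0 : ℚ) < q := by exact_mod_cast hq
  rw [h]
  field_simp
  ring

/-- **`S_j(q, m)/q` is antitone in `q`**: `S_j(q, m) ≤ (q/(m+1))·S_j(m+1, m)` for `q ≥ m + 1`. -/
lemma sliceS_le_diag (m j : ℕ) {q : ℕ} (hq : m + 1 ≤ q) :
    sliceS q m j ≤ (q : ℚ) / ((m : ℚ) + 1) * sliceS (m + 1) m j := by
  induction q, hq using Nat.le_induction with
  | base =>
    rw [show ((m + 1 : ℕ) : ℚ) / ((m : ℚ) + 1) = 1 by push_cast; exact div_self (by positivity), one_mul]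
  | succ q hq ih =>
    rw [sliceS_succ_q q m j (by omega)]
    have h1 : sliceS q m j - sliceS q m (j + 1) ≤ sliceS q m j :=
      sub_le_self _ (sliceS_nonneg q m (j + 1))
    have hq0 : (0 : ℚ) < q := by exact_mod_cast (show 0 < q by omega)
    have hm0 : (0 : ℚ) < (m : ℚ) + 1 := by positivity
    calc ((q : ℚ) + 1) / (q : ℚ) * (sliceS q m j - sliceS q m (j + 1))
        ≤ ((q : ℚ) + 1) / (q : ℚ) * ((q : ℚ) / ((m : ℚ) + 1) * sliceS (m + 1) m j) :=
          mul_le_mul_of_nonneg_left (h1.trans ih) (by positivity)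
      _ = ((q + 1 : ℕ) : ℚ) / ((m : ℚ) + 1) * sliceS (m + 1) m j := by
          push_cast; field_simp

/-- **The lower bound through the diagonal**: `S_j(m+1+t, m) ≥ ((m+1+t)/(m+1))·(J_j(m) − t·J_{j+1}(m))`. -/
lemma sliceS_ge_diag (m j t : ℕ) :
    ((m + 1 + t : ℕ) : ℚ) / ((m : ℚ) + 1) * (sliceS (m + 1) m j - (t : ℚ) * sliceS (m + 1) m (j + 1))
      ≤ sliceS (m + 1 + t) m j := by
  induction t with
  | zero =>
    rw [Nat.cast_zero, zero_mul, sub_zero, add_zero,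
      show ((m + 1 : ℕ) : ℚ) / ((m : ℚ) + 1) = 1 by push_cast; exact div_self (by positivity), one_mul]
  | succ t ih =>
    rw [show m + 1 + (t + 1) = m + 1 + t + 1 by ring, sliceS_succ_q (m + 1 + t) m j (by omega)]
    have hup := sliceS_le_diag m (j + 1) (show m + 1 ≤ m + 1 + t by omega)
    have hQ : (0 : ℚ) < ((m + 1 + t : ℕ) : ℚ) := by positivity
    have hM : (0 : ℚ) < (m : ℚ) + 1 := by positivity
    have hsplit : ((m + 1 + t : ℕ) : ℚ) / ((m : ℚ) + 1)
          * (sliceS (m + 1) m j - ((t + 1 : ℕ) : ℚ) * sliceS (m + 1) m (j + 1))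
        = ((m + 1 + t : ℕ) : ℚ) / ((m : ℚ) + 1) * (sliceS (m + 1) m j - (t : ℚ) * sliceS (m + 1) m (j + 1))
          - ((m + 1 + t : ℕ) : ℚ) / ((m : ℚ) + 1) * sliceS (m + 1) m (j + 1) := by
      push_cast; ring
    have h2 : ((m + 1 + t : ℕ) : ℚ) / ((m : ℚ) + 1)
          * (sliceS (m + 1) m j - ((t + 1 : ℕ) : ℚ) * sliceS (m + 1) m (j + 1))
        ≤ sliceS (m + 1 + t) m j - sliceS (m + 1 + t) m (j + 1) := by
      rw [hsplit]; linarith [ih, hup]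
    calc ((m + 1 + t + 1 : ℕ) : ℚ) / ((m : ℚ) + 1)
          * (sliceS (m + 1) m j - ((t + 1 : ℕ) : ℚ) * sliceS (m + 1) m (j + 1))
        = (((m + 1 + t : ℕ) : ℚ) + 1) / ((m + 1 + t : ℕ) : ℚ)
          * (((m + 1 + t : ℕ) : ℚ) / ((m : ℚ) + 1)
            * (sliceS (m + 1) m j - ((t + 1 : ℕ) : ℚ) * sliceS (m + 1) m (j + 1))) := by
          push_cast; field_simp
      _ ≤ (((m + 1 + t : ℕ) : ℚ) + 1) / ((m + 1 + t : ℕ) : ℚ)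
          * (sliceS (m + 1 + t) m j - sliceS (m + 1 + t) m (j + 1)) :=
          mul_le_mul_of_nonneg_left h2 (by positivity)

/-! ### §2 The diagonal `J_j(m) = S_j(m+1, m)` -/

/-- `J_j(m+1) = ((m+2)/(m+1))·(J_j(m) − J_{j+2}(m))` (Pascal at `q = m+2`, then the slice step at `q = m+1` twice). -/
lemma diag_succ (m j : ℕ) :
    sliceS (m + 1 + 1) (m + 1) j
      = ((m : ℚ) + 2) / ((m : ℚ) + 1) * (sliceS (m + 1) m j - sliceS (m + 1) m (j + 2)) := by
  rw [sliceS_succ_m (m + 1 + 1) m j, sliceS_succ_q (m + 1) m j (by omega),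
    sliceS_succ_q (m + 1) m (j + 1) (by omega), show j + 1 + 1 = j + 2 by ring]
  push_cast
  ring

/-- **`J_{2d+1}(m) = 1/(2·C(m+d+1, d))`** (induction on `m` through `diag_succ`, for all `d` at once). -/
lemma diag_odd (d m : ℕ) : sliceS (m + 1) m (2 * d + 1) = 1 / (2 * ((m + d + 1).choose d : ℚ)) := by
  induction m generalizing d with
  | zero =>
    unfold sliceS
    rw [Finset.sum_range_one, Nat.choose_zero_right, Nat.cast_one,
      show 0 + 1 + (2 * d + 1) + 0 = (2 * d + 1) + 1 by ring, show 0 + (2 * d + 1) = 2 * d + 1 by ring,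
      Nat.choose_succ_self_right, show 0 + d + 1 = d + 1 by ring, Nat.choose_succ_self_right]
    push_cast
    ring
  | succ m ih =>
    rw [diag_succ, ih d, show 2 * d + 1 + 2 = 2 * (d + 1) + 1 by ring, ih (d + 1),
      show m + 1 + d + 1 = m + d + 2 by ring, show m + (d + 1) + 1 = m + d + 2 by ring]
    have h1 := Nat.add_one_mul_choose_eq (m + d + 1) d      -- (m+d+2)·C(m+d+1, d) = C(m+d+2, d+1)·(d+1)
    have h2 := Nat.choose_mul_succ_eq (m + d + 1) d          -- C(m+d+1, d)·(m+d+2) = C(m+d+2, d)·(m+2)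
    rw [show m + d + 1 + 1 = m + d + 2 by ring] at h1 h2
    rw [show m + d + 2 - d = m + 2 by omega] at h2
    have hc1 := congrArg (fun x : ℕ => (x : ℚ)) h1
    have hc2 := congrArg (fun x : ℕ => (x : ℚ)) h2
    push_cast at hc1 hc2
    have hA : (0 : ℚ) < ((m + d + 1).choose d : ℚ) := Nat.cast_pos.mpr (Nat.choose_pos (by omega))
    have hB : (0 : ℚ) < ((m + d + 2).choose (d + 1) : ℚ) := Nat.cast_pos.mpr (Nat.choose_pos (by omega))
    have hC : (0 : ℚ) < ((m + d + 2).choose d : ℚ) := Nat.cast_pos.mpr (Nat.choose_pos (by omega))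
    have hB' : ((m + d + 2).choose (d + 1) : ℚ) = ((m : ℚ) + d + 2) * ((m + d + 1).choose d : ℚ) / ((d : ℚ) + 1) := by
      rw [eq_div_iff (by positivity)]; linarith [hc1]
    have hC' : ((m + d + 2).choose d : ℚ) = ((m : ℚ) + d + 2) * ((m + d + 1).choose d : ℚ) / ((m : ℚ) + 2) := by
      rw [eq_div_iff (by positivity)]; linarith [hc2]
    rw [hB', hC']
    field_simp
    ring

/-! ### §3 The sharp Wallis bound and the second diagonal sum -/

/-- `X_{Q+1} = X_Q·(2Q+2)/(2Q+1)` for `X_Q = 4^Q/C(2Q, Q)` (`Nat.succ_mul_centralBinom_succ`). -/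
lemma xq_succ (Q : ℕ) :
    (4 : ℚ) ^ (Q + 1) / ((2 * (Q + 1)).choose (Q + 1) : ℚ)
      = (4 : ℚ) ^ Q / ((2 * Q).choose Q : ℚ) * ((2 * (Q : ℚ) + 2) / (2 * (Q : ℚ) + 1)) := by
  have h := Nat.succ_mul_centralBinom_succ Q
  rw [Nat.centralBinom_eq_two_mul_choose, Nat.centralBinom_eq_two_mul_choose] at h
  have hc := congrArg (fun x : ℕ => (x : ℚ)) h
  push_cast at hc
  have hA : (0 : ℚ) < ((2 * Q).choose Q : ℚ) := Nat.cast_pos.mpr (Nat.choose_pos (by omega))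
  have hB : (0 : ℚ) < ((2 * (Q + 1)).choose (Q + 1) : ℚ) := Nat.cast_pos.mpr (Nat.choose_pos (by omega))
  rw [div_mul_div_comm, div_eq_div_iff hB.ne' (by positivity), pow_succ]
  linear_combination (-2 * (4 : ℚ) ^ Q) * hc

/-- **The sharp Wallis bound** `X_Q² ≤ (8/9)·(2Q+1)²/(Q+1)` for `Q ≥ 1` (equality at `Q = 1`; the step is
`4(Q+1)(Q+2) ≤ (2Q+3)²`). -/
lemma xq_sq_le_sharp (Q : ℕ) (hQ : 1 ≤ Q) :
    ((4 : ℚ) ^ Q / ((2 * Q).choose Q : ℚ)) ^ 2 ≤ 8 / 9 * (2 * (Q : ℚ) + 1) ^ 2 / ((Q : ℚ) + 1) := by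
  induction Q, hQ using Nat.le_induction with
  | base => norm_num [Nat.choose_one_right]
  | succ Q _ ih =>
    rw [xq_succ, mul_pow]
    have hpos : (0 : ℚ) ≤ ((2 * (Q : ℚ) + 2) / (2 * (Q : ℚ) + 1)) ^ 2 := by positivity
    calc ((4 : ℚ) ^ Q / ((2 * Q).choose Q : ℚ)) ^ 2 * ((2 * (Q : ℚ) + 2) / (2 * (Q : ℚ) + 1)) ^ 2
        ≤ 8 / 9 * (2 * (Q : ℚ) + 1) ^ 2 / ((Q : ℚ) + 1) * ((2 * (Q : ℚ) + 2) / (2 * (Q : ℚ) + 1)) ^ 2 :=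
          mul_le_mul_of_nonneg_right ih hpos
      _ = 32 / 9 * ((Q : ℚ) + 1) := by field_simp; ring
      _ ≤ 8 / 9 * (2 * ((Q + 1 : ℕ) : ℚ) + 1) ^ 2 / (((Q + 1 : ℕ) : ℚ) + 1) := by
          push_cast
          rw [le_div_iff₀ (by positivity)]
          nlinarith

/-- **`(2·J_2(m))² ≤ 8/(9(m+2))`** (`slice_two_succ_diag` and the sharp Wallis bound at `Q = m + 1`). -/
lemma diag_two_sq_le (m : ℕ) : (2 * sliceS (m + 1) m 2) ^ 2 ≤ 8 / (9 * ((m : ℚ) + 2)) := by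
  have h : sliceS (m + 1) m 2
      = ((4 : ℚ) ^ (m + 1) / ((2 * m + 2).choose (m + 1) : ℚ)) / (2 * (2 * (m : ℚ) + 3)) :=
    slice_two_succ_diag m
  have hw := xq_sq_le_sharp (m + 1) (by omega)
  rw [show 2 * (m + 1) = 2 * m + 2 by ring] at hw
  push_cast at hw
  rw [h]
  have h3 : (0 : ℚ) < 2 * (m : ℚ) + 3 := by positivity
  calc (2 * ((4 : ℚ) ^ (m + 1) / ((2 * m + 2).choose (m + 1) : ℚ) / (2 * (2 * (m : ℚ) + 3)))) ^ 2
      = ((4 : ℚ) ^ (m + 1) / ((2 * m + 2).choose (m + 1) : ℚ)) ^ 2 / (2 * (m : ℚ) + 3) ^ 2 := by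
        field_simp
    _ ≤ (8 / 9 * (2 * ((m : ℚ) + 1) + 1) ^ 2 / ((m : ℚ) + 1 + 1)) / (2 * (m : ℚ) + 3) ^ 2 :=
        div_le_div_of_nonneg_right hw (by positivity)
    _ = 8 / (9 * ((m : ℚ) + 2)) := by field_simp; ring

/-! ### §4 The two bounds used downstream -/

/-- **`S_1(m+1+t, m) ≥ ((m+1+t)/(2(m+1)))·(1 − t·(2J_2(m)))`** (`J_1 = 1/2`). -/
lemma sliceS_one_ge (m t : ℕ) :
    ((m + 1 + t : ℕ) : ℚ) / (2 * ((m : ℚ) + 1)) * (1 - (t : ℚ) * (2 * sliceS (m + 1) m 2))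
      ≤ sliceS (m + 1 + t) m 1 := by
  have h := sliceS_ge_diag m 1 t
  rw [show (1 : ℕ) + 1 = 2 from rfl] at h
  have h1 : sliceS (m + 1) m 1 = 1 / 2 := slice_one_succ_diag m
  rw [h1] at h
  calc ((m + 1 + t : ℕ) : ℚ) / (2 * ((m : ℚ) + 1)) * (1 - (t : ℚ) * (2 * sliceS (m + 1) m 2))
      = ((m + 1 + t : ℕ) : ℚ) / ((m : ℚ) + 1) * (1 / 2 - (t : ℚ) * sliceS (m + 1) m 2) := by
        field_simp
    _ ≤ sliceS (m + 1 + t) m 1 := h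

/-- **`S_j(q, m) ≤ (q/(m+1))·1/(2·C(m+d+1, d))`** for `2d + 1 ≤ j` and `m + 1 ≤ q`. -/
lemma sliceS_le_odd (m j d : ℕ) {q : ℕ} (hq : m + 1 ≤ q) (hj : 2 * d + 1 ≤ j) :
    sliceS q m j ≤ (q : ℚ) / ((m : ℚ) + 1) * (1 / (2 * ((m + d + 1).choose d : ℚ))) := by
  calc sliceS q m j ≤ (q : ℚ) / ((m : ℚ) + 1) * sliceS (m + 1) m j := sliceS_le_diag m j hq
    _ ≤ (q : ℚ) / ((m : ℚ) + 1) * sliceS (m + 1) m (2 * d + 1) :=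
        mul_le_mul_of_nonneg_left (sliceS_anti (m + 1) m hj) (by positivity)
    _ = _ := by rw [diag_odd]

end PercRepro
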